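import Literature.NumberTheory.Automorphic.UnitaryGroupTruncatedTraceClassPolynomialOfRowsTwo
import Literature.NumberTheory.Automorphic.UnitaryGroupTruncatedTraceClassDifferenceUnfoldingTwo
import Literature.NumberTheory.Automorphic.UnitaryGroupKernelBorelClassHomogeneityTwo
import Literature.NumberTheory.Automorphic.UnitaryGroupTruncatedTraceWindowPartsTwo
import Literature.NumberTheory.Automorphic.AdelicUnitaryGroupUnimodularQuasiSplit
import Literature.NumberTheory.Automorphic.UnitaryGroupTruncatedKernelIntegrableCM
import Literature.NumberTheory.Automorphic.UnitaryGroupArchimedean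
import Literature.NumberTheory.Automorphic.UnitaryGroupTruncatedKernelClassIntegrableHoldsTwo
import HarnessLib

/-!
# `J^T_𝔬(f)` is a polynomial in `log T` of degree `≤ 1` on `U(J₂)`, class by class, from the per-class integrability
# of `k^T_𝔬` alone — item (3c) of the H-side LAW 3 road
(Arthur, *The trace formula in invariant form*, Ann. of Math. 114 (1981), Prop. 2.3; Rogawski, *Automorphic Representations
of Unitary Groups in Three Variables* (1990), §2.3 p. 14, for the rank-one groups `U(3)`, `U(2)`, `U(2) × U(1)` of §7.3
p. 98; Shokranian (1992), Thm. (5.7): degree `dim(A_B/A_G) = 1`.)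

Topic `NumberTheory/Automorphic`; namespace `Literature.NumberTheory.Automorphic.UnitaryGroup`. THEOREMS ONLY over accepted
tree modules: no definition, no named fact, no instance, no notation, no `sorry`. The `N = 2` sibling of ★
`UnitaryGroupTruncatedTraceClassPolynomialHolds` up to its last line: ★ (3c-e)₂ `truncatedTraceClassPolynomial_of_parts_two`
with EVERY analytic input discharged — `hhom` by ★ `kernelBorelClass_borel_mul_mul_two` (`UnitaryGroupKernelBorelClassHomogeneityTwo`),
`hparts` by ★ `exists_truncatedTraceClass_sub_eq_parts_two'` (`UnitaryGroupTruncatedTraceClassDifferenceUnfoldingTwo`), `hwin` by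
★ `exists_lintegral_weight_windowPart_eq_two` (`UnitaryGroupTruncatedTraceWindowPartsTwo`), unimodularity by ★
`forall_isHaarMeasure_isMulRightInvariant_quasiSplit_cm_two` (`AdelicUnitaryGroupUnimodularQuasiSplit`) — so that the per-class
polynomial of `U(J₂)` follows from the PER-CLASS INTEGRABILITY of `k^T_𝔬` ALONE (the LAW 1 rows at `N = 2`,
`UnitaryGroupTruncatedKernelClassIntegrableOfRowsTwo` ∕ `…OfSiegelTwo`; the hypothesis-free closer `truncatedTraceClassPolynomial_two_cm`
is the one-line ED. 2 of this file the hour their closer lands). H-SIDE copy of LAWS 1–5 (`H = U(Φ₂) × U(Φ₁)`; LEAD WORDs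
#123∕#124; census `CENSUS-LAWS-Hside.F0P3a-p03g6.md` §3 LAW 2∕LAW 3) of the T1 line `Cruxes/H413/Lines/F0_T1InnerFormTraceIdentity.lean`
(cell `pub/hodgecm-mathlib`, crux H413).

* `truncatedTraceClassPolynomial_of_truncatedKernelClassIntegrable_two` — generic quadratic `E/F` (`c² = 1 ≠ c`, `[E:F] = 2`,
  `c` fixing the infinite places, unimodularity of `U(J₂)(𝔸_F)` as hypotheses).
* **`truncatedTraceClassPolynomial_cm_two_of_integrable`** — at the CM pair `(L⁺, L, complexConj)`: from per-class integrability alone.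

## References

* J. Arthur, *The trace formula in invariant form*, Ann. of Math. 114 (1981), Prop. 2.3 [Arthur1981TraceFormulaInvariantForm].
* J. D. Rogawski, *Automorphic Representations of Unitary Groups in Three Variables*, Ann. of Math. Stud. 123 (1990), §2.3 (p. 14),
  §7.3 (p. 98) [Rogawski1990].
* S. Shokranian, *The Selberg–Arthur Trace Formula*, LNM 1503 (1992), Thm. (5.7), Rem. (5.8) [Shokranian1992].
-/

set_option autoImplicit false

noncomputable section

open MeasureTheory Measure NumberField IsDedekindDomain Set Polynomial Literature.MeasureTheory.Group
open scoped NNReal ENNReal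

namespace Literature.NumberTheory.Automorphic

namespace UnitaryGroup

variable {F E : Type} [Field F] [NumberField F] [Field E] [NumberField E] [Algebra F E]
  {c : E ≃ₐ[F] E} {ι : Type*}

/-- **`J^T_𝔬(f)` is affine in `log T` on `U(J₂)` for a quadratic `E/F`, from the per-class integrability of `k^T_𝔬`**
(`c² = 1 ≠ c`, `[E:F] = 2`, `c` fixes the infinite places of `E`, unimodularity of `U(J₂)(𝔸_F)`): ★ (3c-e)₂ with `hhom`, `hparts`
and `hwin` discharged by ★ `kernelBorelClass_borel_mul_mul_two`, ★ `exists_truncatedTraceClass_sub_eq_parts_two'`, ★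
`exists_lintegral_weight_windowPart_eq_two`. [cite: Arthur1981TraceFormulaInvariantForm, Prop. 2.3] [cite: Rogawski1990, §2.3 (p. 14)] -/
theorem truncatedTraceClassPolynomial_of_truncatedKernelClassIntegrable_two (hc : c * c = 1) (hc1 : c ≠ 1)
    (h2 : Module.finrank F E = 2) (hfix : ∀ w : InfinitePlace E, c • w = w)
    (hunimod : ∀ [MeasurableSpace (quasiSplit F E c 2).Adelic] [BorelSpace (quasiSplit F E c 2).Adelic]
      (νG : Measure (quasiSplit F E c 2).Adelic), νG.IsHaarMeasure → νG.IsMulRightInvariant)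
    {cl : (quasiSplit F E c 2).arithmeticSubgroup → ι} (hcl : IsConjInvariant cl)
    (hclN : IsUnipotentInvariantOnBorel F E c 2 cl) (i : ι)
    (hint : ∀ [MeasurableSpace (adelicUnipotent F E c 2)] [BorelSpace (adelicUnipotent F E c 2)]
      (ν : Measure (adelicUnipotent F E c 2)) [ν.IsHaarMeasure] (𝓕 : Set (adelicUnipotent F E c 2)),
      IsFundamentalDomain (rationalUnipotent F E c 2) 𝓕 ν →
      ∀ (μ : Measure (quasiSplit F E c 2).automorphicQuotient) [(quasiSplit F E c 2).IsAutomorphicMeasure μ]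
        (f : (quasiSplit F E c 2).Adelic → ℂ), IsQuasiSplitTest F E c 2 f →
      ∃ T₀ : ℝ≥0, ∀ T : ℝ≥0, T₀ < T →
        Integrable ((quasiSplit F E c 2).quotFun (truncatedKernelClass ν 𝓕 T cl i f)) μ) :
    ∀ [MeasurableSpace (adelicUnipotent F E c 2)] [BorelSpace (adelicUnipotent F E c 2)]
      (ν : Measure (adelicUnipotent F E c 2)) [ν.IsHaarMeasure] (𝓕 : Set (adelicUnipotent F E c 2)),
      IsFundamentalDomain (rationalUnipotent F E c 2) 𝓕 ν →
      ∀ (μ : Measure (quasiSplit F E c 2).automorphicQuotient) [(quasiSplit F E c 2).IsAutomorphicMeasure μ]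
        (f : (quasiSplit F E c 2).Adelic → ℂ), IsQuasiSplitTest F E c 2 f →
      ∃ p : ℂ[X], p.natDegree ≤ 1 ∧ ∃ T₀ : ℝ≥0, ∀ T : ℝ≥0, T₀ < T →
        truncatedTraceClass μ ν 𝓕 T cl i f = p.eval ((Real.log (T : ℝ) : ℝ) : ℂ) :=
  truncatedTraceClassPolynomial_of_parts_two hunimod cl i
    (fun ν _ _ h𝓕 _ hfc hf b x y => by
      haveI := locallyCompactSpace_adeleRing' E
      letI : MeasurableSpace (AdeleRing (𝓞 E) E) := borel _
      haveI : BorelSpace (AdeleRing (𝓞 E) E) := ⟨rfl⟩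
      exact kernelBorelClass_borel_mul_mul_two hc hc1 ν h𝓕 hclN hfc hf b x y i)
    (fun ν _ 𝓕 h𝓕 μ _ νG _ _ f hfc _ β hβ =>
      exists_truncatedTraceClass_sub_eq_parts_two' hcl hclN i ν 𝓕 h𝓕 μ νG f hfc β hβ)
    hint
    (fun νG _ μK _ β hβ => exists_lintegral_weight_windowPart_eq_two h2 hc hc1 hfix νG μK β hβ)

/-- **EVERY `J^T_𝔬(f)` IS A POLYNOMIAL IN `log T` OF DEGREE `≤ 1` on `U(J₂)` of a CM field, FROM THE PER-CLASS INTEGRABILITY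
OF `k^T_𝔬` ALONE** — for every class map `cl : G(F) → ι` with Rogawski's two partition axioms and every class `i`: the
hypotheses `c² = 1 ≠ c`, `[L : L⁺] = 2`, `c` fixes `∞`, unimodularity are discharged at the CM pair (★
`complexConj_mul_complexConj`, `IsCMField.complexConj_ne_one`, `Algebra.IsQuadraticExtension.finrank_eq_two`, ★
`complexConj_smul_infinitePlace`, ★ `forall_isHaarMeasure_isMulRightInvariant_quasiSplit_cm_two`). The remaining input `hint`
is the `N = 2` LAW 1 class row (`UnitaryGroupTruncatedKernelClassIntegrableOfRowsTwo` ∕ the Siegel closer).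
[cite: Arthur1981TraceFormulaInvariantForm, Prop. 2.3] [cite: Rogawski1990, §2.3 (p. 14)] [cite: Shokranian1992, Thm. (5.7) and Rem. (5.8)] -/
theorem truncatedTraceClassPolynomial_cm_two_of_integrable (L : Type) [Field L] [NumberField L] [IsCMField L]
    {cl : (quasiSplit (↥(maximalRealSubfield L)) L (IsCMField.complexConj L) 2).arithmeticSubgroup → ι}
    (hcl : IsConjInvariant cl)
    (hclN : IsUnipotentInvariantOnBorel (↥(maximalRealSubfield L)) L (IsCMField.complexConj L) 2 cl) (i : ι)
    (hint : ∀ [MeasurableSpace (adelicUnipotent (↥(maximalRealSubfield L)) L (IsCMField.complexConj L) 2)]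
      [BorelSpace (adelicUnipotent (↥(maximalRealSubfield L)) L (IsCMField.complexConj L) 2)]
      (ν : Measure (adelicUnipotent (↥(maximalRealSubfield L)) L (IsCMField.complexConj L) 2)) [ν.IsHaarMeasure]
      (𝓕 : Set (adelicUnipotent (↥(maximalRealSubfield L)) L (IsCMField.complexConj L) 2)),
      IsFundamentalDomain (rationalUnipotent (↥(maximalRealSubfield L)) L (IsCMField.complexConj L) 2) 𝓕 ν →
      ∀ (μ : Measure (quasiSplit (↥(maximalRealSubfield L)) L (IsCMField.complexConj L) 2).automorphicQuotient)
        [(quasiSplit (↥(maximalRealSubfield L)) L (IsCMField.complexConj L) 2).IsAutomorphicMeasure μ]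
        (f : (quasiSplit (↥(maximalRealSubfield L)) L (IsCMField.complexConj L) 2).Adelic → ℂ),
        IsQuasiSplitTest (↥(maximalRealSubfield L)) L (IsCMField.complexConj L) 2 f →
      ∃ T₀ : ℝ≥0, ∀ T : ℝ≥0, T₀ < T →
        Integrable ((quasiSplit (↥(maximalRealSubfield L)) L (IsCMField.complexConj L) 2).quotFun (truncatedKernelClass ν 𝓕 T cl i f)) μ) :
    ∀ [MeasurableSpace (adelicUnipotent (↥(maximalRealSubfield L)) L (IsCMField.complexConj L) 2)]
      [BorelSpace (adelicUnipotent (↥(maximalRealSubfield L)) L (IsCMField.complexConj L) 2)]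
      (ν : Measure (adelicUnipotent (↥(maximalRealSubfield L)) L (IsCMField.complexConj L) 2)) [ν.IsHaarMeasure]
      (𝓕 : Set (adelicUnipotent (↥(maximalRealSubfield L)) L (IsCMField.complexConj L) 2)),
      IsFundamentalDomain (rationalUnipotent (↥(maximalRealSubfield L)) L (IsCMField.complexConj L) 2) 𝓕 ν →
        ∀ (μ : Measure (quasiSplit (↥(maximalRealSubfield L)) L (IsCMField.complexConj L) 2).automorphicQuotient)
          [(quasiSplit (↥(maximalRealSubfield L)) L (IsCMField.complexConj L) 2).IsAutomorphicMeasure μ]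
          (f : (quasiSplit (↥(maximalRealSubfield L)) L (IsCMField.complexConj L) 2).Adelic → ℂ),
          IsQuasiSplitTest (↥(maximalRealSubfield L)) L (IsCMField.complexConj L) 2 f →
          ∃ p : ℂ[X], p.natDegree ≤ 1 ∧ ∃ T₀ : ℝ≥0, ∀ T : ℝ≥0, T₀ < T →
            truncatedTraceClass μ ν 𝓕 T cl i f = p.eval ((Real.log (T : ℝ) : ℝ) : ℂ) :=
  truncatedTraceClassPolynomial_of_truncatedKernelClassIntegrable_two (complexConj_mul_complexConj L)
    (IsCMField.complexConj_ne_one L) (Algebra.IsQuadraticExtension.finrank_eq_two (↥(maximalRealSubfield L)) L)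
    (complexConj_smul_infinitePlace L) (forall_isHaarMeasure_isMulRightInvariant_quasiSplit_cm_two L) hcl hclN i hint


/-! ## ED. 2 — the hypothesis-free closer -/

/-- **(ED. 2) EVERY `J^T_𝔬(f)` IS A POLYNOMIAL IN `log T` OF DEGREE `≤ 1` on `U(J₂)` of a CM field — NO further hypothesis**:
for every class map `cl : G(F) → ι` with Rogawski's two partition axioms and every class `i`, for every Haar measure `ν` of
`N(𝔸)`, fundamental domain `𝓕`, automorphic measure `μ` and quasi-split test function `f` there is `p ∈ ℂ[X]`, `deg p ≤ 1`, with
`J^T_𝔬(f) = p(log T)` for all large `T` (Arthur (1981), Prop. 2.3; Rogawski (1990), §2.3, §7.3): `truncatedTraceClassPolynomial_cm_two_of_integrable`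
fed with the `N = 2` LAW 1 class row ★ `truncatedKernelClassIntegrable_cm_two` (`UnitaryGroupTruncatedKernelClassIntegrableHoldsTwo`).
The `N = 2` twin of ★ `truncatedTraceClassPolynomial_cm`. [cite: Arthur1981TraceFormulaInvariantForm, Prop. 2.3]
[cite: Rogawski1990, §2.3 (p. 14)] [cite: Shokranian1992, Thm. (5.7) and Rem. (5.8)] -/
theorem truncatedTraceClassPolynomial_two_cm (L : Type) [Field L] [NumberField L] [IsCMField L]
    {cl : (quasiSplit (↥(maximalRealSubfield L)) L (IsCMField.complexConj L) 2).arithmeticSubgroup → ι}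
    (hcl : IsConjInvariant cl)
    (hclN : IsUnipotentInvariantOnBorel (↥(maximalRealSubfield L)) L (IsCMField.complexConj L) 2 cl) (i : ι) :
    ∀ [MeasurableSpace (adelicUnipotent (↥(maximalRealSubfield L)) L (IsCMField.complexConj L) 2)]
      [BorelSpace (adelicUnipotent (↥(maximalRealSubfield L)) L (IsCMField.complexConj L) 2)]
      (ν : Measure (adelicUnipotent (↥(maximalRealSubfield L)) L (IsCMField.complexConj L) 2)) [ν.IsHaarMeasure]
      (𝓕 : Set (adelicUnipotent (↥(maximalRealSubfield L)) L (IsCMField.complexConj L) 2)),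
      IsFundamentalDomain (rationalUnipotent (↥(maximalRealSubfield L)) L (IsCMField.complexConj L) 2) 𝓕 ν →
        ∀ (μ : Measure (quasiSplit (↥(maximalRealSubfield L)) L (IsCMField.complexConj L) 2).automorphicQuotient)
          [(quasiSplit (↥(maximalRealSubfield L)) L (IsCMField.complexConj L) 2).IsAutomorphicMeasure μ]
          (f : (quasiSplit (↥(maximalRealSubfield L)) L (IsCMField.complexConj L) 2).Adelic → ℂ),
          IsQuasiSplitTest (↥(maximalRealSubfield L)) L (IsCMField.complexConj L) 2 f →
          ∃ p : ℂ[X], p.natDegree ≤ 1 ∧ ∃ T₀ : ℝ≥0, ∀ T : ℝ≥0, T₀ < T →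
            truncatedTraceClass μ ν 𝓕 T cl i f = p.eval ((Real.log (T : ℝ) : ℝ) : ℂ) :=
  truncatedTraceClassPolynomial_cm_two_of_integrable L hcl hclN i
    (fun ν _ 𝓕 h𝓕 μ _ f hf => truncatedKernelClassIntegrable_cm_two L hcl hclN ν 𝓕 h𝓕 μ f hf i)

end UnitaryGroup

end Literature.NumberTheory.Automorphic
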